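import Summits.BirchSwinnertonDyer.BirchSwinnertonDyer.Theorems.GenusKolyvaginAtTwoVisiblePairAtTwoInputReductionsHeegner
import Summits.BirchSwinnertonDyer.BirchSwinnertonDyer.Theorems.GenusKolyvaginAtTwoVisiblePairAtTwoInstanceDefs
import Summits.BirchSwinnertonDyer.BirchSwinnertonDyer.Theorems.GenusKolyvaginAtTwoVisiblePairAtTwoCebotarev
import HarnessLib

/-!
# Route `GenusKolyvaginAtTwo`, LINE 6, KEY crux Q3 (inner statement of stmt-BirchSwinnertonDyer-22137):
# the visible pair data `Input` BUILT FROM THE `K`-STATEMENT on the Heegner habitat, and Kolyvagin's Claims A/B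
# over `ℚ` at `2` with HONEST hypotheses: classes + descent identities, Q2 over `K`, Lemma 4.3 over `K`, (H2),
# DEF-freeness

Helper (seat `bsd-line-gk2-p3` g13; `--supports` the crux, closes nothing). The record `VisiblePairAtTwo.Input`
(`…VisiblePairAtTwoDefs`, p638903) displays McCallum's Lemma 4.3 OVER `ℚ` for the descended classes at every place
(`loc_c₁_fin/inf`, `loc_c₂_fin/inf`) and Cor. 3.2 in visible form (`cebotarev`). Both are now theorems of the tree on
the LINE-6 habitat: `cebotarev` is gk2-p2's `input_cebotarev` (p640754); the `loc` fields follow from Lemma 4.3 OVER `K`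
plus the arithmetic DEF-free condition `∀ v ∣ d_K, #E(ℚ_v)[2] = 1` (`loc_c₁_fin_of_K_of_heegner`,
`loc_c₂_fin_of_K_of_heegner`, `…InputReductionsHeegner`; `∞` is free on `Δ < 0`). This file assembles:

* `exists_input_of_K` — **an `Input W K M hθ hθsq` with prescribed `x`, `M₀`, `c₁`, `c₂`, `cK` EXISTS** given only:
  the habitat (`E` globally minimal non-CM, `Δ < 0`, `ρ_{E,2^n}` onto ∀ `n`, `K` imaginary quadratic, `d_K` odd,
  `d_K·(−|Δ|)` non-square, Heegner hypothesis for `N_E`, `M ≥ 1`), the classes with `c_M(1) = 2^{M₀} x` and the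
  descent identities, **Q2 over `K`** (`rel`), **Lemma 4.3 over `K`** (`hK43`), **(H2)** (`sel_visible`) and
  **DEF-freeness** (`htors`);
* `pow_zsmul_selmer_eq_zero_and_selmer_le_of_K` — **Claims A and B over `ℚ` at `2` in honest form**:
  `2^{M₀}·Sel^{(2^M)}(E^{(d_K)}/ℚ) = 0` and `2^{2M₀}·Sel^{(2^M)}(E/ℚ) ⊆ ℤx`, from exactly those hypotheses
  (Kolyvagin's Theorem `B_2` in exponent form, read through gk2-p2's `VisiblePairHypothesesM.pow_zsmul_sel₂_eq_zero_and_sel₁_le`);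
* `selmer_twin_eq_bot_and_selmer_eq_of_K_of_M₀_eq_zero` — the case `M₀ = 0`: `Sel^{(2^M)}(E^{(d_K)}/ℚ) = 0` and
  `Sel^{(2^M)}(E/ℚ) = ℤx`.

What remains DISPLAYED is exactly what the tree does not prove: the classes `c₁ c₂ cK x` with their identities (from
`KolyvaginHeegnerData` + `…EigenClassesFinite`), Q2 = `KolyvaginRelationAtTwo` over `K` in the currency
`FrobEqFrobInfty W K (2^M) ℓ`, McCallum's Lemma 4.3 over `K`, the habitat condition (H2), and the DEF-free condition.
THEOREMS ONLY (no definition, no named fact, no `sorry`, standard axioms). BSD is not proved by any of this.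

References: [Kolyvagin1989Izv] §3 (Thm. `B_l` at `l = 2`, criterion `B_2(E, D)`); [McCallumLMS1991] §1 Theorem, §3 Cor.
3.2, §4 Lemma 4.3, Prop. 4.4, §5; [GrossLMS1991] §3, §10.
-/

set_option autoImplicit false
set_option linter.dupNamespace false -- tree convention: `Summit.BirchSwinnertonDyer.BirchSwinnertonDyer.Theorems` (summit = sub-problem)

noncomputable section

open scoped Classical

namespace Summit.BirchSwinnertonDyer.BirchSwinnertonDyer.Theorems.GenusExact.VisiblePairAtTwo

open WeierstrassCurve NumberField IsDedekindDomain Field Rat.HeightOneSpectrum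
open Literature.NumberTheory.EllipticCurves Literature.NumberTheory.GaloisRepresentations
open Literature.NumberTheory.EllipticCurves.KolyvaginDescent

variable (W : WeierstrassCurve ℚ) [W.IsElliptic] [W.IsGloballyMinimal] (K : Type) [Field K] [NumberField K]
  (M : ℕ) {θ : K} (hθ : θ ∉ Set.range (algebraMap ℚ K))
  (hθsq : θ ^ 2 = algebraMap ℚ K ((NumberField.discr K : ℤ) : ℚ))

/-- **The visible pair data from the `K`-statement.** On the LINE-6 habitat (`E` globally minimal non-CM, `Δ(E) < 0`,
`ρ_{E,2^n}` onto for all `n`, `K = ℚ(θ)` imaginary quadratic with `θ² = d_K` odd, `d_K·(−|Δ|)` not a square, every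
`p ∣ N_E` split in `K`, `M ≥ 1`), classes `x`, `c₁`, `c₂`, `c_K` with `c₁ 1 = 2^{M₀} x` and the descent identities,
the Kolyvagin relation OVER `K` (`rel`), Lemma 4.3 OVER `K` (`hK43`), the visibility (H2) of the pair Selmer group and the
DEF-free condition `∀ v ∣ d_K, #E(ℚ_v)[2] = 1` furnish an `Input W K M hθ hθsq` with these data: Lemma 4.3 over `ℚ` at
the finite places by `loc_c₁_fin_of_K_of_heegner` / `loc_c₂_fin_of_K_of_heegner`, at `∞` by `Δ < 0`, and Cor. 3.2 in
visible form by `input_cebotarev`. [cite: McCallumLMS1991, §3 Cor. 3.2, §4 Lemma 4.3, §5]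
[cite: Kolyvagin1989Izv, §3] -/
theorem exists_input_of_K [(twin W K).IsElliptic] (hcm : ¬ W.HasCM) (hΔ : W.Δ < 0)
    (hK : IsImaginaryQuadratic K) (hodd : Odd (NumberField.discr K))
    (hns : ¬ IsSquare ((NumberField.discr K : ℚ) * -|W.Δ|)) (hρ : ∀ n : ℕ, W.HasSurjectiveModNGaloisRep (2 ^ n : ℕ))
    (hH : SatisfiesHeegnerHypothesis (W.conductorNorm ℤ) K) (hM : 1 ≤ M)
    (x : galH1Torsion W (lvl M)) (x_mem : x ∈ selmerGroup W (lvl M)) (x_ord : ((2 : ℤ) ^ (M - 1)) • x ≠ 0)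
    (M₀ : ℕ) (c₁ : ℕ → galH1Torsion W (lvl M)) (c₂ : ℕ → galH1Torsion (twin W K) (lvl M))
    (cK : ℕ → galH1Torsion (W.baseChange K) (lvl M)) (c_one : c₁ 1 = ((2 : ℤ) ^ M₀) • x)
    (res_c₁ : ∀ m, KolSupp (kolPrime W K M) m → Even m.primeFactors.card →
      resTorsion W K (lvl M) (c₁ m) = cK m)
    (res_c₂ : ∀ m, KolSupp (kolPrime W K M) m → Odd m.primeFactors.card →
      hPsiKT W K hθ hθsq (lvl M) (resTorsion (twin W K) K (lvl M) (c₂ m)) = cK m)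
    (rel : ∀ ℓ m, kolPrime W K M ℓ → KolSupp (kolPrime W K M) (ℓ * m) →
      ∀ w : HeightOneSpectrum (𝓞 K), (ℓ : 𝓞 K) ∈ w.asIdeal → ∀ a : ℕ,
        ((2 : ℤ) ^ a) • cK (ℓ * m) ∈ selmerLocalKer (W.baseChange K) (w.adicCompletion K) (lvl M) ↔
          ((2 : ℤ) ^ a) • cK m ∈ (W.baseChange K).torsionLocalKer (w.adicCompletion K) (lvl M))
    (hK43 : ∀ m, KolSupp (kolPrime W K M) m → ∀ w : HeightOneSpectrum (𝓞 K), (m : 𝓞 K) ∉ w.asIdeal →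
      cK m ∈ selmerLocalKer (W.baseChange K) (w.adicCompletion K) (lvl M))
    (sel_visible : ∀ s₁ ∈ selmerGroup W (lvl M), ∀ s₂ ∈ selmerGroup (twin W K) (lvl M),
      rK₁ W K M s₁ + rK₂ W M hθ hθsq s₂ = 0 → s₁ = 0 ∧ s₂ = 0)
    (htors : ∀ v : HeightOneSpectrum (𝓞 ℚ), ((NumberField.discr K : ℤ) : 𝓞 ℚ) ∈ v.asIdeal →
      Nat.card (nsmulAddMonoidHom 2 : (W.baseChange (v.adicCompletion ℚ)).toAffine.Point →+ _).ker = 1) :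
    ∃ I : Input W K M hθ hθsq, I.x = x ∧ I.M₀ = M₀ ∧ I.c₁ = c₁ ∧ I.c₂ = c₂ ∧ I.cK = cK :=
  ⟨{ hK := hK
     hodd := hodd
     hΔ := hΔ
     hM := hM
     x := x
     x_mem := x_mem
     x_ord := x_ord
     M₀ := M₀
     c₁ := c₁
     c₂ := c₂
     cK := cK
     c_one := c_one
     res_c₁ := res_c₁
     res_c₂ := res_c₂
     rel := rel
     loc_c₁_fin := loc_c₁_fin_of_K_of_heegner W hθ hθsq hK.1 hodd hH c₁ cK res_c₁ hK43 htors
     loc_c₁_inf := loc_c₁_inf_of_Δ_neg W hΔ _ _ c₁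
     loc_c₂_fin := loc_c₂_fin_of_K_of_heegner W hθ hθsq hK.1 hodd hH c₂ cK res_c₂ hK43 htors
     loc_c₂_inf := loc_c₂_inf_of_Δ_neg W hΔ _ _ c₂
     sel_visible := sel_visible
     cebotarev := input_cebotarev W K M hθ hθsq hcm hΔ hK hodd hns hρ hM }, rfl, rfl, rfl, rfl, rfl⟩

/-- **Kolyvagin's Claims A and B over `ℚ` at `2`, honest form** (Theorem `B_2` in exponent form for the pair
`(E, E^{(d_K)})`): on the LINE-6 habitat, given the classes with their descent identities, Q2 over `K`, Lemma 4.3 over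
`K`, (H2) and DEF-freeness (as in `exists_input_of_K`):
`2^{M₀} · Sel^{(2^M)}(E^{(d_K)}/ℚ) = 0` and `2^{2M₀} · Sel^{(2^M)}(E/ℚ) ⊆ ℤ x`. Nothing about BSD is proved here.
[cite: Kolyvagin1989Izv, §3 (Thm. B_l, l = 2)] [cite: McCallumLMS1991, §1 Theorem and §5] -/
theorem pow_zsmul_selmer_eq_zero_and_selmer_le_of_K [(twin W K).IsElliptic] (hcm : ¬ W.HasCM) (hΔ : W.Δ < 0)
    (hK : IsImaginaryQuadratic K) (hodd : Odd (NumberField.discr K))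
    (hns : ¬ IsSquare ((NumberField.discr K : ℚ) * -|W.Δ|)) (hρ : ∀ n : ℕ, W.HasSurjectiveModNGaloisRep (2 ^ n : ℕ))
    (hH : SatisfiesHeegnerHypothesis (W.conductorNorm ℤ) K) (hM : 1 ≤ M)
    (x : galH1Torsion W (lvl M)) (x_mem : x ∈ selmerGroup W (lvl M)) (x_ord : ((2 : ℤ) ^ (M - 1)) • x ≠ 0)
    (M₀ : ℕ) (c₁ : ℕ → galH1Torsion W (lvl M)) (c₂ : ℕ → galH1Torsion (twin W K) (lvl M))
    (cK : ℕ → galH1Torsion (W.baseChange K) (lvl M)) (c_one : c₁ 1 = ((2 : ℤ) ^ M₀) • x)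
    (res_c₁ : ∀ m, KolSupp (kolPrime W K M) m → Even m.primeFactors.card →
      resTorsion W K (lvl M) (c₁ m) = cK m)
    (res_c₂ : ∀ m, KolSupp (kolPrime W K M) m → Odd m.primeFactors.card →
      hPsiKT W K hθ hθsq (lvl M) (resTorsion (twin W K) K (lvl M) (c₂ m)) = cK m)
    (rel : ∀ ℓ m, kolPrime W K M ℓ → KolSupp (kolPrime W K M) (ℓ * m) →
      ∀ w : HeightOneSpectrum (𝓞 K), (ℓ : 𝓞 K) ∈ w.asIdeal → ∀ a : ℕ,
        ((2 : ℤ) ^ a) • cK (ℓ * m) ∈ selmerLocalKer (W.baseChange K) (w.adicCompletion K) (lvl M) ↔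
          ((2 : ℤ) ^ a) • cK m ∈ (W.baseChange K).torsionLocalKer (w.adicCompletion K) (lvl M))
    (hK43 : ∀ m, KolSupp (kolPrime W K M) m → ∀ w : HeightOneSpectrum (𝓞 K), (m : 𝓞 K) ∉ w.asIdeal →
      cK m ∈ selmerLocalKer (W.baseChange K) (w.adicCompletion K) (lvl M))
    (sel_visible : ∀ s₁ ∈ selmerGroup W (lvl M), ∀ s₂ ∈ selmerGroup (twin W K) (lvl M),
      rK₁ W K M s₁ + rK₂ W M hθ hθsq s₂ = 0 → s₁ = 0 ∧ s₂ = 0)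
    (htors : ∀ v : HeightOneSpectrum (𝓞 ℚ), ((NumberField.discr K : ℤ) : 𝓞 ℚ) ∈ v.asIdeal →
      Nat.card (nsmulAddMonoidHom 2 : (W.baseChange (v.adicCompletion ℚ)).toAffine.Point →+ _).ker = 1) :
    (∀ s ∈ selmerGroup (twin W K) (lvl M), ((2 : ℤ) ^ M₀) • s = 0) ∧
      ∀ s ∈ selmerGroup W (lvl M), ∃ a : ℤ, ((2 : ℤ) ^ (2 * M₀)) • s = a • x := by
  obtain ⟨I, hx, hM₀, -, -, -⟩ := exists_input_of_K W K M hθ hθsq hcm hΔ hK hodd hns hρ hH hM x x_mem x_ord M₀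
    c₁ c₂ cK c_one res_c₁ res_c₂ rel hK43 sel_visible htors
  have h := pow_zsmul_selmer_eq_zero_and_selmer_le I
  rw [hx, hM₀] at h
  exact h

/-- **`M₀ = 0` over `ℚ`, honest form**: if moreover `c_M(1) = x` (the Heegner class is `2`-primitive at level `2^M`)
then `Sel^{(2^M)}(E^{(d_K)}/ℚ) = 0` and `Sel^{(2^M)}(E/ℚ) = ℤ x` — from the `K`-statement, (H2) and DEF-freeness.
[cite: Kolyvagin1989Izv, §3 (Thm. B_l, l = 2)] [cite: GrossLMS1991, §10] -/
theorem selmer_twin_eq_bot_and_selmer_eq_of_K_of_M₀_eq_zero [(twin W K).IsElliptic] (hcm : ¬ W.HasCM)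
    (hΔ : W.Δ < 0) (hK : IsImaginaryQuadratic K) (hodd : Odd (NumberField.discr K))
    (hns : ¬ IsSquare ((NumberField.discr K : ℚ) * -|W.Δ|)) (hρ : ∀ n : ℕ, W.HasSurjectiveModNGaloisRep (2 ^ n : ℕ))
    (hH : SatisfiesHeegnerHypothesis (W.conductorNorm ℤ) K) (hM : 1 ≤ M)
    (x : galH1Torsion W (lvl M)) (x_mem : x ∈ selmerGroup W (lvl M)) (x_ord : ((2 : ℤ) ^ (M - 1)) • x ≠ 0)
    (c₁ : ℕ → galH1Torsion W (lvl M)) (c₂ : ℕ → galH1Torsion (twin W K) (lvl M))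
    (cK : ℕ → galH1Torsion (W.baseChange K) (lvl M)) (c_one : c₁ 1 = x)
    (res_c₁ : ∀ m, KolSupp (kolPrime W K M) m → Even m.primeFactors.card →
      resTorsion W K (lvl M) (c₁ m) = cK m)
    (res_c₂ : ∀ m, KolSupp (kolPrime W K M) m → Odd m.primeFactors.card →
      hPsiKT W K hθ hθsq (lvl M) (resTorsion (twin W K) K (lvl M) (c₂ m)) = cK m)
    (rel : ∀ ℓ m, kolPrime W K M ℓ → KolSupp (kolPrime W K M) (ℓ * m) →
      ∀ w : HeightOneSpectrum (𝓞 K), (ℓ : 𝓞 K) ∈ w.asIdeal → ∀ a : ℕ,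
        ((2 : ℤ) ^ a) • cK (ℓ * m) ∈ selmerLocalKer (W.baseChange K) (w.adicCompletion K) (lvl M) ↔
          ((2 : ℤ) ^ a) • cK m ∈ (W.baseChange K).torsionLocalKer (w.adicCompletion K) (lvl M))
    (hK43 : ∀ m, KolSupp (kolPrime W K M) m → ∀ w : HeightOneSpectrum (𝓞 K), (m : 𝓞 K) ∉ w.asIdeal →
      cK m ∈ selmerLocalKer (W.baseChange K) (w.adicCompletion K) (lvl M))
    (sel_visible : ∀ s₁ ∈ selmerGroup W (lvl M), ∀ s₂ ∈ selmerGroup (twin W K) (lvl M),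
      rK₁ W K M s₁ + rK₂ W M hθ hθsq s₂ = 0 → s₁ = 0 ∧ s₂ = 0)
    (htors : ∀ v : HeightOneSpectrum (𝓞 ℚ), ((NumberField.discr K : ℤ) : 𝓞 ℚ) ∈ v.asIdeal →
      Nat.card (nsmulAddMonoidHom 2 : (W.baseChange (v.adicCompletion ℚ)).toAffine.Point →+ _).ker = 1) :
    selmerGroup (twin W K) (lvl M) = ⊥ ∧ selmerGroup W (lvl M) = AddSubgroup.zmultiples x := by
  obtain ⟨I, hx, hM₀, -, -, -⟩ := exists_input_of_K W K M hθ hθsq hcm hΔ hK hodd hns hρ hH hM x x_mem x_ord 0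
    c₁ c₂ cK (by rw [pow_zero, one_smul]; exact c_one) res_c₁ res_c₂ rel hK43 sel_visible htors
  have h := selmer_twin_eq_bot_and_selmer_eq_of_M₀_eq_zero I hM₀
  rw [hx] at h
  exact h

end Summit.BirchSwinnertonDyer.BirchSwinnertonDyer.Theorems.GenusExact.VisiblePairAtTwo

end
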